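/-
Copyright (c) 2026 the pub-hodgecm-mathlib formalisation cell (harness21).  Prover seat hodgecm-mathlib-K2E1-p16 (g4), Track B ∕ K2-LIT, h413 = `stmt-HodgeConjecture-24833`,
R90-TF section S8 «ContSpec-n½», socket (E) :276 (N₃) row per `K_∞`-type, S8 dealer R90-CS-plan (g4) S8-R296 (1): THE τ-CUT ASSEMBLER — the `hcut τ` letter of ★ `hNblk_of_tauCuts`
from the E1-PLANCHEREL BODY bricks (★ PB-0′ p865366, ★ PB-3∕PB-4 p865235∕p865260, ★ PB-3b p865153, ★ τ-cut estate p865068 ∕ `hScP_tauCut_of_record`) through ★ (N_blk,₃)-conv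
`resG_isotypic_le_orthogonal_of_lineModel_of_conv`, HYPOTHESIS-FIRST on exactly the PB-2 (Gram) and PB-3a (Hecke) letters.  ★ S8 files only.
-/
import Summits.HodgeConjecture.HodgeConjecture.Theorems.R90S8ResGIsotypicTauLinesU3            -- ★ p864980 (this seat): `resG_isotypic_le_orthogonal_of_lineModel_of_conv` ((N_blk,₃)-conv at any `(K′, ω)`, `Ln`)
import Summits.HodgeConjecture.HodgeConjecture.Theorems.R90S8ResGBlockProjectorFixTauU3         -- ★ (F0P2-p10): `hScP_tauCut_of_record` (`Sc ⊓ N ≤ Fix Pr_τ` from `R_K(χ) = id` on `N`)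
import Summits.HodgeConjecture.HodgeConjecture.Theorems.R90S8PlancherelLineModelOfGram          -- ★ p865235∕p865260 (this seat): `exists_lineModelLetters_of_gram_residueGram` (PB-3 + PB-4)
import Summits.HodgeConjecture.HodgeConjecture.Theorems.R90S8ResGBlockTauCutDensityU3          -- ★ p865366 (this seat): PB-0′; brings ★ Lit `charProj_eq_self_iff_mem_isotypicComponent`
import HarnessLib

/-!
# R90-TF · S8 «ContSpec-n½» — `R90S8ResGTauCutLettersOfPlancherelBodyU3`: THE τ-CUT ASSEMBLER `hcut_of_plancherelBody`

Cell `hodgecm-mathlib`, crux H413 (`stmt-HodgeConjecture-24833`, lane `--supports … --as helper`), route of record `HCCMUnconditional`; R90-TF section S8, socket (E) `sock_S8_res_exhaustion_le_closure`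
(B ED. 7 :276).  The (N₃) row of (E) is ★ `hNblk_of_tauCuts` (glue over `K_∞`-types) whose input is, per irreducible `K_∞`-type `τ`, the τ-CUT LETTER
`hcut τ : ∀ W irreducible residual, W ⊓ Fix(ι_f Kf) ≤ (Sc ⊓ N_τ ⊓ Aᗮ)ᗮ`.  THIS FILE assembles `hcut τ` from the E1-Plancherel bricks: the τ-cut projector estate (`χ = χ_τ♮`, `e` the level
idempotent, `P = R_K(χ) ∘L R_f(e)`: ★ p865068, whose rows are the binders `hχτ hχconv hχinv he0 he1 heK hestar hPdef` here), `hLnP` (★ `hScP_tauCut_of_record` with `R_K(χ_τ♮) = id` on `N_τ`: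
★ junction `integratedOperator_apply_eq_charProj` + ★ `charProj_eq_self_iff_mem_isotypicComponent`), the LINE MODEL `U hU hLnU` (★ `exists_lineModelLetters_of_gram_residueGram` at
`Sc′ := Sc ⊓ N_τ` from the PB-2 letters `hG hee hxe hr hRA` and the PB-3a letters `hTx hTadjx hSymb`, generators `x` with `hΘ : closure span {x i} = Sc ⊓ N_τ` — PB-0′ ★ p865366 at the
record), the (L3) letter `hline` (★ p865153 for Satake-shaped symbols), and the body ★ `resG_isotypic_le_orthogonal_of_lineModel_of_conv` at `Ln := Sc ⊓ N_τ ⊓ Aᗮ`; the finite-level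
fixed space `Fix(ι_f Kf)` lies in `Fix_{ι_f Kf}(1)` (inline, as in ★ `hNblk_of_lineModel`).  THEOREMS ONLY (no `def`, no `instance`, no `notation`, no named-fact hypothesis, no `sorry`;
default heartbeats); generic compact `K` read in `U(J₃)(L⁺⊗ℝ)` through `κ` (record: `K_∞ = U(J₃)(L⁺⊗ℝ) ∩ U(1⊗1)`, `κ` the inclusion); count-neutral; CLOSES NO SOCKET.
* **`hcut_of_plancherelBody`** — the `hcut τ` BYTES (generic `K, κ`, generators `x`), hypothesis-first on {estate rows (★-dischargeable), PB-2, PB-3a (+ operator letters `hT𝓐 hTP hTB`), `hΘ`, `hline`}.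
* **`hcut_of_plancherelBody_of_record`** — `K := K_∞`, `κ :=` inclusion, `x :=` the PB-0′ generators `[θ_{f, e_τ φ}]` (★ p865366, `χ₁` unitary): `hΘ` discharged; letters over any enumeration `x` of the generator set.
HONEST LABEL: HC_CM is proved only modulo the 7 printed citations (2 remaining named inputs: hLiu418 = `stmt-HodgeConjecture-24832`, h413 = `stmt-HodgeConjecture-24833`) until rung 0
closes; an assembler pays no letter — after it the τ-cut row of (E) reads ★ modulo EXACTLY {PB-2 `hG hee hxe hr hRA` (contour shift + residues), PB-3a `hTx hTadjx hSymb` + `hT𝓐 hTP hTB`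
(unramified Hecke action on flat sections), the (L3) symbol shape}; REL ≠ ★ ≠ BUILT; asserts no named fact, closes no socket; count-neutral.

## References
* [MoeglinWaldspurger1995] C. Mœglin, J.-L. Waldspurger, *Spectral Decomposition and Eisenstein Series* (1995), II.2.4, IV.3.12, V.3.13, VI.2.
* [BrockerTomDieck1985] T. Bröcker, T. tom Dieck, *Representations of Compact Lie Groups*, GTM 98 (1985), III Thm. (5.10).
* [DeitmarEchterhoff2014] A. Deitmar, S. Echterhoff, *Principles of Harmonic Analysis* (2nd ed., 2014), Prop. 7.3.3.
-/

set_option autoImplicit false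
set_option linter.dupNamespace false  -- the mandated namespace `…HodgeConjecture.HodgeConjecture.R90.S8` (LEAD #1 L1) repeats the summit's segment

noncomputable section

open MeasureTheory Filter Topology CompactlySupported NumberField ContRepresentation Set
open scoped InnerProductSpace ENNReal ComplexConjugate
open Literature.NumberTheory Literature.NumberTheory.Automorphic Literature.NumberTheory.Automorphic.UnitaryGroup Literature.NumberTheory.GaloisRepresentations AdelicGroupData
open Literature.NumberTheory.Automorphic.Arthur2013.Leaves.TECR
open Literature.RepresentationTheory.CompactGroups
open Summit.HodgeConjecture.HodgeConjecture.Cruxes.H413.K2E1CuspidalSpectrumUnitary (residualSubspace)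
open Summit.HodgeConjecture.HodgeConjecture.Cruxes.H413.K2E1HeckeAlgebraLettersCM
open Summit.HodgeConjecture.HodgeConjecture.Cruxes.H413.K2E1BorelEisensteinU
open Summit.HodgeConjecture.HodgeConjecture.Cruxes.H413.K2E1CharacterEisensteinU3PairDefs
open Summit.HodgeConjecture.HodgeConjecture.Cruxes.H413.K2E1ChiSectionSpaceU3PairDefs

namespace Summit.HodgeConjecture.HodgeConjecture.R90.S8

section Assembly

variable (L : Type) [Field L] [NumberField L] [IsCMField L]
  (μ : Measure (quasiSplit (↥(maximalRealSubfield L)) L (IsCMField.complexConj L) 3).automorphicQuotient)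
  [(quasiSplit (↥(maximalRealSubfield L)) L (IsCMField.complexConj L) 3).IsAutomorphicMeasure μ]
  {K : Type*} [Group K] [TopologicalSpace K] [IsTopologicalGroup K] [MeasurableSpace K] [BorelSpace K] [SecondCountableTopology K] [CompactSpace K] [T2Space K]
  [MeasurableSpace (UnitaryGroup.arch (↥(maximalRealSubfield L)) L (IsCMField.complexConj L) 3 ((StdForm.antidiagonal 3).over L))] [BorelSpace (UnitaryGroup.arch (↥(maximalRealSubfield L)) L (IsCMField.complexConj L) 3 ((StdForm.antidiagonal 3).over L))]
  [MeasurableSpace (finAdelic (↥(maximalRealSubfield L)) L (IsCMField.complexConj L) 3 ((StdForm.antidiagonal 3).over L))] [BorelSpace (finAdelic (↥(maximalRealSubfield L)) L (IsCMField.complexConj L) 3 ((StdForm.antidiagonal 3).over L))]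
  (νinf : Measure (UnitaryGroup.arch (↥(maximalRealSubfield L)) L (IsCMField.complexConj L) 3 ((StdForm.antidiagonal 3).over L))) [IsFiniteMeasureOnCompacts νinf] [νinf.IsMulLeftInvariant] [νinf.IsInvInvariant] [νinf.IsOpenPosMeasure]
  (νf : Measure (finAdelic (↥(maximalRealSubfield L)) L (IsCMField.complexConj L) 3 ((StdForm.antidiagonal 3).over L))) [IsFiniteMeasureOnCompacts νf] [νf.IsMulLeftInvariant] [νf.IsInvInvariant] [νf.IsOpenPosMeasure]
  (κ : K →* UnitaryGroup.arch (↥(maximalRealSubfield L)) L (IsCMField.complexConj L) 3 ((StdForm.antidiagonal 3).over L)) (hκ : Continuous κ)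
  (μK : Measure K) [IsFiniteMeasureOnCompacts μK] [IsProbabilityMeasure μK] [μK.IsMulLeftInvariant] [MeasurableInv K] [μK.IsInvInvariant]
  (χ : C_c(K, ℂ)) (e : C_c(finAdelic (↥(maximalRealSubfield L)) L (IsCMField.complexConj L) 3 ((StdForm.antidiagonal 3).over L), ℂ))
  {Ω : Type*} {mΩ : MeasurableSpace Ω} (m : Measure Ω) {E : Type*} [NormedAddCommGroup E] [InnerProductSpace ℂ E] [CompleteSpace E] {J : Type*} [Countable J]
variable [ENNReal.HolderTriple ∞ 2 2]

/-- **THE τ-CUT ASSEMBLER `hcut_of_plancherelBody`.**  Frame: Mok's `U(J₃)`, the block of record `Sc = resGBlock L μ (ι_f Kf) 1 χ₁ χ₂` (`Kf` open `≤ K₀`, `χ₂` automorphic), a compact `K`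
read through `κ` (record: `K_∞`, inclusion), an irreducible unitary `K`-type `τ` with isotypic component `N_τ` of `ρ = R ∘ ι_∞ ∘ κ`, the visible residue space `A`.  BINDERS: the τ-cut
projector estate `χ hχτ hχconv hχinv e he0 he1 heK hestar P hPdef` (★ p865068), the operator letters `T hT𝓐 hTP hTB`, the PB-3a letters `σ hTx hTadjx s hs hSymb`, the PB-2 letters
`x r c hG eres b hee hxe hr hRA`, the τ-cut density `hΘ : closure span {x i} = Sc ⊓ N_τ` (★ PB-0′ at the record) and the (L3) letter `hline` (★ PB-3b).  CONCLUSION: the `hcut τ` bytes of ★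
`hNblk_of_tauCuts` — every irreducible closed `W ≤ L²_res(𝔓)` has `W ⊓ Fix(ι_f Kf) ≤ (Sc ⊓ N_τ ⊓ Aᗮ)ᗮ`.  Proof: `hLnP` by ★ `hScP_tauCut_of_record` (`R_K(χ) = e_τ = id` on `N_τ`), `U hU hLnU` by ★
`exists_lineModelLetters_of_gram_residueGram`, then ★ `resG_isotypic_le_orthogonal_of_lineModel_of_conv` at `Ln := Sc ⊓ N_τ ⊓ Aᗮ` and `Fix(ι_f Kf) ≤ Fix_{ι_f Kf}(1)`.
[cite: MoeglinWaldspurger1995, II.2.4, VI.2] [cite: BrockerTomDieck1985, III Thm. (5.10)] [cite: DeitmarEchterhoff2014, Prop. 7.3.3] -/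
theorem hcut_of_plancherelBody (𝔓 : (quasiSplit (↥(maximalRealSubfield L)) L (IsCMField.complexConj L) 3).ParabolicUnipotentData)
    (Kf : {Kf : Subgroup ↥(finAdelic (↥(maximalRealSubfield L)) L (IsCMField.complexConj L) 3 ((StdForm.antidiagonal 3).over L)) // IsOpen ((Kf : Subgroup ↥(finAdelic (↥(maximalRealSubfield L)) L (IsCMField.complexConj L) 3 ((StdForm.antidiagonal 3).over L))) : Set ↥(finAdelic (↥(maximalRealSubfield L)) L (IsCMField.complexConj L) 3 ((StdForm.antidiagonal 3).over L))) ∧ Kf ≤ ((((standardMaximalCompactGL 3 L).comap (adelicVal (↥(maximalRealSubfield L)) L (IsCMField.complexConj L) 3 ((StdForm.antidiagonal 3).over L)) : Subgroup (quasiSplit (↥(maximalRealSubfield L)) L (IsCMField.complexConj L) 3).Adelic)).comap (finAdelicToAdelic (↥(maximalRealSubfield L)) L (IsCMField.complexConj L) 3 ((StdForm.antidiagonal 3).over L)) : Subgroup ↥(finAdelic (↥(maximalRealSubfield L)) L (IsCMField.complexConj L) 3 ((StdForm.antidiagonal 3).over L)))})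
    (χ₁ : HeckeCharacter L) {χ₂ : ↥(TorusDict.torus (IsCMField.complexConj L)) →ₜ* ℂˣ} (hχ₂ : TorusDict.IsAutomorphic (IsCMField.complexConj L) χ₂)
    {Eτ : Type*} [NormedAddCommGroup Eτ] [InnerProductSpace ℂ Eτ] [FiniteDimensional ℂ Eτ] (τ : ContRepresentation ℂ K Eτ) (hτc : Continuous (τ : K → Eτ →L[ℂ] Eτ))
    [τ.toRepresentation.IsIrreducible] (hτu : ∀ (k : K) (v w : Eτ), ⟪τ k v, τ k w⟫_ℂ = ⟪v, w⟫_ℂ)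
    (hχτ : ∀ k, χ k = (Module.finrank ℂ Eτ : ℂ) * conj (Schur.character τ k)) (hχconv : ∀ x, χ x = mulConv μK (⇑χ) (⇑χ) x) (hχinv : ∀ k, conj (χ k⁻¹) = χ k)
    (he0 : ∀ x : finAdelic (↥(maximalRealSubfield L)) L (IsCMField.complexConj L) 3 ((StdForm.antidiagonal 3).over L), x ∉ Kf.1 → e x = 0) (he1 : ∫ x, e x ∂νf = 1) (heK : ∀ k ∈ Kf.1, ∀ x, e (k * x) = e x) (hestar : ∀ x : finAdelic (↥(maximalRealSubfield L)) L (IsCMField.complexConj L) 3 ((StdForm.antidiagonal 3).over L), mulStar (⇑e) x = e x)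
    (P : (quasiSplit (↥(maximalRealSubfield L)) L (IsCMField.complexConj L) 3).L2 μ →L[ℂ] (quasiSplit (↥(maximalRealSubfield L)) L (IsCMField.complexConj L) 3).L2 μ)
    (hPdef : P = ((((quasiSplit (↥(maximalRealSubfield L)) L (IsCMField.complexConj L) 3).rightRegular μ).restrict ((archToAdelic (↥(maximalRealSubfield L)) L (IsCMField.complexConj L) 3 ((StdForm.antidiagonal 3).over L)).comp κ)).integratedOperator (((quasiSplit (↥(maximalRealSubfield L)) L (IsCMField.complexConj L) 3).isUnitary_rightRegular μ).restrict _)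
          (((quasiSplit (↥(maximalRealSubfield L)) L (IsCMField.complexConj L) 3).isStronglyContinuous_rightRegular_holds μ).restrict _ ((continuous_archToAdelic (↥(maximalRealSubfield L)) L (IsCMField.complexConj L) 3 ((StdForm.antidiagonal 3).over L)).comp hκ)) μK χ ∘L
        (((quasiSplit (↥(maximalRealSubfield L)) L (IsCMField.complexConj L) 3).rightRegular μ).restrict (finAdelicToAdelic (↥(maximalRealSubfield L)) L (IsCMField.complexConj L) 3 ((StdForm.antidiagonal 3).over L))).integratedOperator (((quasiSplit (↥(maximalRealSubfield L)) L (IsCMField.complexConj L) 3).isUnitary_rightRegular μ).restrict _) (((quasiSplit (↥(maximalRealSubfield L)) L (IsCMField.complexConj L) 3).isStronglyContinuous_rightRegular_holds μ).restrict _ (continuous_finAdelicToAdelic (↥(maximalRealSubfield L)) L (IsCMField.complexConj L) 3 ((StdForm.antidiagonal 3).over L))) νf e))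
    (T : J → (quasiSplit (↥(maximalRealSubfield L)) L (IsCMField.complexConj L) 3).L2 μ →L[ℂ] (quasiSplit (↥(maximalRealSubfield L)) L (IsCMField.complexConj L) 3).L2 μ)
    (hT𝓐 : ∀ j, T j ∈ {A' : (quasiSplit (↥(maximalRealSubfield L)) L (IsCMField.complexConj L) 3).L2 μ →L[ℂ] (quasiSplit (↥(maximalRealSubfield L)) L (IsCMField.complexConj L) 3).L2 μ | ∃ (a : C_c(UnitaryGroup.arch (↥(maximalRealSubfield L)) L (IsCMField.complexConj L) 3 ((StdForm.antidiagonal 3).over L), ℂ)) (b : C_c(finAdelic (↥(maximalRealSubfield L)) L (IsCMField.complexConj L) 3 ((StdForm.antidiagonal 3).over L), ℂ)),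
      A' = (((quasiSplit (↥(maximalRealSubfield L)) L (IsCMField.complexConj L) 3).rightRegular μ).restrict (archToAdelic (↥(maximalRealSubfield L)) L (IsCMField.complexConj L) 3 ((StdForm.antidiagonal 3).over L))).integratedOperator (((quasiSplit (↥(maximalRealSubfield L)) L (IsCMField.complexConj L) 3).isUnitary_rightRegular μ).restrict _) (((quasiSplit (↥(maximalRealSubfield L)) L (IsCMField.complexConj L) 3).isStronglyContinuous_rightRegular_holds μ).restrict _ (continuous_archToAdelic (↥(maximalRealSubfield L)) L (IsCMField.complexConj L) 3 ((StdForm.antidiagonal 3).over L))) νinf a ∘L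
          (((quasiSplit (↥(maximalRealSubfield L)) L (IsCMField.complexConj L) 3).rightRegular μ).restrict (finAdelicToAdelic (↥(maximalRealSubfield L)) L (IsCMField.complexConj L) 3 ((StdForm.antidiagonal 3).over L))).integratedOperator (((quasiSplit (↥(maximalRealSubfield L)) L (IsCMField.complexConj L) 3).isUnitary_rightRegular μ).restrict _) (((quasiSplit (↥(maximalRealSubfield L)) L (IsCMField.complexConj L) 3).isStronglyContinuous_rightRegular_holds μ).restrict _ (continuous_finAdelicToAdelic (↥(maximalRealSubfield L)) L (IsCMField.complexConj L) 3 ((StdForm.antidiagonal 3).over L))) νf b})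
    (hTP : ∀ j, Commute P (T j))
    (hTB : ∀ j, ∀ A' ∈ {A' : (quasiSplit (↥(maximalRealSubfield L)) L (IsCMField.complexConj L) 3).L2 μ →L[ℂ] (quasiSplit (↥(maximalRealSubfield L)) L (IsCMField.complexConj L) 3).L2 μ | ∃ (a : C_c(UnitaryGroup.arch (↥(maximalRealSubfield L)) L (IsCMField.complexConj L) 3 ((StdForm.antidiagonal 3).over L), ℂ)) (b : C_c(finAdelic (↥(maximalRealSubfield L)) L (IsCMField.complexConj L) 3 ((StdForm.antidiagonal 3).over L), ℂ)),
      A' = (((quasiSplit (↥(maximalRealSubfield L)) L (IsCMField.complexConj L) 3).rightRegular μ).restrict (archToAdelic (↥(maximalRealSubfield L)) L (IsCMField.complexConj L) 3 ((StdForm.antidiagonal 3).over L))).integratedOperator (((quasiSplit (↥(maximalRealSubfield L)) L (IsCMField.complexConj L) 3).isUnitary_rightRegular μ).restrict _) (((quasiSplit (↥(maximalRealSubfield L)) L (IsCMField.complexConj L) 3).isStronglyContinuous_rightRegular_holds μ).restrict _ (continuous_archToAdelic (↥(maximalRealSubfield L)) L (IsCMField.complexConj L) 3 ((StdForm.antidiagonal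 3).over L))) νinf a ∘L
          (((quasiSplit (↥(maximalRealSubfield L)) L (IsCMField.complexConj L) 3).rightRegular μ).restrict (finAdelicToAdelic (↥(maximalRealSubfield L)) L (IsCMField.complexConj L) 3 ((StdForm.antidiagonal 3).over L))).integratedOperator (((quasiSplit (↥(maximalRealSubfield L)) L (IsCMField.complexConj L) 3).isUnitary_rightRegular μ).restrict _) (((quasiSplit (↥(maximalRealSubfield L)) L (IsCMField.complexConj L) 3).isStronglyContinuous_rightRegular_holds μ).restrict _ (continuous_finAdelicToAdelic (↥(maximalRealSubfield L)) L (IsCMField.complexConj L) 3 ((StdForm.antidiagonal 3).over L))) νf b},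
      ∀ x ∈ LinearMap.eqLocus (P : (quasiSplit (↥(maximalRealSubfield L)) L (IsCMField.complexConj L) 3).L2 μ →ₗ[ℂ] (quasiSplit (↥(maximalRealSubfield L)) L (IsCMField.complexConj L) 3).L2 μ) LinearMap.id, P (A' (T j x)) = T j (P (A' x)))
    {ι : Type*} (x : ι → (quasiSplit (↥(maximalRealSubfield L)) L (IsCMField.complexConj L) 3).L2 μ) {M₁ : Type*} [NormedAddCommGroup M₁] [InnerProductSpace ℂ M₁] [CompleteSpace M₁] (r : ι → M₁) (c : ι → Lp E 2 m)
    (hG : ∀ i j, ⟪x i, x j⟫_ℂ = ⟪r i, r j⟫_ℂ + ⟪c i, c j⟫_ℂ)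
    {kι : Type*} (eres : kι → (quasiSplit (↥(maximalRealSubfield L)) L (IsCMField.complexConj L) 3).L2 μ) (b : kι → M₁)
    (hee : ∀ p q, ⟪eres p, eres q⟫_ℂ = ⟪b p, b q⟫_ℂ) (hxe : ∀ i p, ⟪x i, eres p⟫_ℂ = ⟪r i, b p⟫_ℂ) (hr : ∀ i, r i ∈ (Submodule.span ℂ (Set.range b)).topologicalClosure)
    (σ : J → ι → ι) (hTx : ∀ j i, T j (x i) = x (σ j i)) (hTadjx : ∀ j i, ContinuousLinearMap.adjoint (T j) (x i) ∈ (Submodule.span ℂ (Set.range x)).topologicalClosure)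
    (s : J → Ω → ℂ) (hs : ∀ j, MemLp (s j) ∞ m) (hSymb : ∀ j i, c (σ j i) = (hs j).toLp (s j) • c i)
    (A : Submodule ℂ ((quasiSplit (↥(maximalRealSubfield L)) L (IsCMField.complexConj L) 3).L2 μ)) (hRA : (Submodule.span ℂ (Set.range eres)).topologicalClosure ≤ A)
    (hΘ : (Submodule.span ℂ (Set.range x)).topologicalClosure = resGBlock L μ (Kf.1.map (finAdelicToAdelic (↥(maximalRealSubfield L)) L (IsCMField.complexConj L) 3 ((StdForm.antidiagonal 3).over L))) 1 χ₁ χ₂ ⊓ ((((quasiSplit (↥(maximalRealSubfield L)) L (IsCMField.complexConj L) 3).rightRegular μ).restrict ((archToAdelic (↥(maximalRealSubfield L)) L (IsCMField.complexConj L) 3 ((StdForm.antidiagonal 3).over L)).comp κ)).isotypicComponent τ).toSubmodule)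
    (hline : ∀ cst : J → ℂ, m {y | ∀ j, s j y = cst j} = 0) :
    ∀ W : ClosedSubrep ((quasiSplit (↥(maximalRealSubfield L)) L (IsCMField.complexConj L) 3).rightRegular μ), W.toContRep.IsTopIrreducible → W ≤ residualSubspace (quasiSplit (↥(maximalRealSubfield L)) L (IsCMField.complexConj L) 3) μ 𝔓 →
      W.toSubmodule ⊓ (⨅ u : ↥(Kf.1), Module.End.eigenspace ((((quasiSplit (↥(maximalRealSubfield L)) L (IsCMField.complexConj L) 3).rightRegular μ) (finAdelicToAdelic (↥(maximalRealSubfield L)) L (IsCMField.complexConj L) 3 ((StdForm.antidiagonal 3).over L) (u : ↥(finAdelic (↥(maximalRealSubfield L)) L (IsCMField.complexConj L) 3 ((StdForm.antidiagonal 3).over L)))) :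
        (quasiSplit (↥(maximalRealSubfield L)) L (IsCMField.complexConj L) 3).L2 μ →L[ℂ] (quasiSplit (↥(maximalRealSubfield L)) L (IsCMField.complexConj L) 3).L2 μ) : (quasiSplit (↥(maximalRealSubfield L)) L (IsCMField.complexConj L) 3).L2 μ →ₗ[ℂ] (quasiSplit (↥(maximalRealSubfield L)) L (IsCMField.complexConj L) 3).L2 μ) 1) ≤ (resGBlock L μ (Kf.1.map (finAdelicToAdelic (↥(maximalRealSubfield L)) L (IsCMField.complexConj L) 3 ((StdForm.antidiagonal 3).over L))) 1 χ₁ χ₂ ⊓ ((((quasiSplit (↥(maximalRealSubfield L)) L (IsCMField.complexConj L) 3).rightRegular μ).restrict ((archToAdelic (↥(maximalRealSubfield L)) L (IsCMField.complexConj L) 3 ((StdForm.antidiagonal 3).over L)).comp κ)).isotypicComponent τ).toSubmodule ⊓ Aᗮ)ᗮ := by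
  intro W hW hres
  -- `ρ = R ∘ ι_∞ ∘ κ` is unitary and strongly continuous
  have hρu : (((quasiSplit (↥(maximalRealSubfield L)) L (IsCMField.complexConj L) 3).rightRegular μ).restrict ((archToAdelic (↥(maximalRealSubfield L)) L (IsCMField.complexConj L) 3 ((StdForm.antidiagonal 3).over L)).comp κ)).IsUnitary := fun k => ((quasiSplit (↥(maximalRealSubfield L)) L (IsCMField.complexConj L) 3).isUnitary_rightRegular μ) _
  have hρc : (((quasiSplit (↥(maximalRealSubfield L)) L (IsCMField.complexConj L) 3).rightRegular μ).restrict ((archToAdelic (↥(maximalRealSubfield L)) L (IsCMField.complexConj L) 3 ((StdForm.antidiagonal 3).over L)).comp κ)).IsStronglyContinuous :=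
    ((quasiSplit (↥(maximalRealSubfield L)) L (IsCMField.complexConj L) 3).isStronglyContinuous_rightRegular_holds μ).restrict _ ((continuous_archToAdelic (↥(maximalRealSubfield L)) L (IsCMField.complexConj L) 3 ((StdForm.antidiagonal 3).over L)).comp hκ)
  -- (a) the line model at `Sc′ := Sc ⊓ N_τ` (PB-3 + PB-4 over PB-2, PB-3a, PB-0′)
  obtain ⟨U, -, hU, -, hLnU⟩ := exists_lineModelLetters_of_gram_residueGram x r c hG eres b hee hxe hr T σ hTx hTadjx s hs hSymb (resGBlock L μ (Kf.1.map (finAdelicToAdelic (↥(maximalRealSubfield L)) L (IsCMField.complexConj L) 3 ((StdForm.antidiagonal 3).over L))) 1 χ₁ χ₂ ⊓ ((((quasiSplit (↥(maximalRealSubfield L)) L (IsCMField.complexConj L) 3).rightRegular μ).restrict ((archToAdelic (↥(maximalRealSubfield L)) L (IsCMField.complexConj L) 3 ((StdForm.antidiagonal 3).over L)).comp κ)).isotypicComponent τ).toSubmodule) A hΘ hRA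
  -- (b) `R_K(χ_τ♮) = id` on `N_τ`, hence `Sc ⊓ N_τ ≤ Fix P`
  have hN : ∀ v ∈ ((((quasiSplit (↥(maximalRealSubfield L)) L (IsCMField.complexConj L) 3).rightRegular μ).restrict ((archToAdelic (↥(maximalRealSubfield L)) L (IsCMField.complexConj L) 3 ((StdForm.antidiagonal 3).over L)).comp κ)).isotypicComponent τ).toSubmodule,
      (((quasiSplit (↥(maximalRealSubfield L)) L (IsCMField.complexConj L) 3).rightRegular μ).restrict ((archToAdelic (↥(maximalRealSubfield L)) L (IsCMField.complexConj L) 3 ((StdForm.antidiagonal 3).over L)).comp κ)).integratedOperator (((quasiSplit (↥(maximalRealSubfield L)) L (IsCMField.complexConj L) 3).isUnitary_rightRegular μ).restrict _)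
          (((quasiSplit (↥(maximalRealSubfield L)) L (IsCMField.complexConj L) 3).isStronglyContinuous_rightRegular_holds μ).restrict _ ((continuous_archToAdelic (↥(maximalRealSubfield L)) L (IsCMField.complexConj L) 3 ((StdForm.antidiagonal 3).over L)).comp hκ)) μK χ v = v := fun v hv =>
    (integratedOperator_apply_eq_charProj μK τ _ _ _ hχτ v).trans ((charProj_eq_self_iff_mem_isotypicComponent μK hρc hρu hτc hτu v).2 hv)
  have hScP := hScP_tauCut_of_record L μ νf Kf e he0 he1 χ₁ hχ₂ κ hκ μK χ (((((quasiSplit (↥(maximalRealSubfield L)) L (IsCMField.complexConj L) 3).rightRegular μ).restrict ((archToAdelic (↥(maximalRealSubfield L)) L (IsCMField.complexConj L) 3 ((StdForm.antidiagonal 3).over L)).comp κ)).isotypicComponent τ).toSubmodule) hN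
  have hLnP : ∀ v ∈ resGBlock L μ (Kf.1.map (finAdelicToAdelic (↥(maximalRealSubfield L)) L (IsCMField.complexConj L) 3 ((StdForm.antidiagonal 3).over L))) 1 χ₁ χ₂ ⊓ ((((quasiSplit (↥(maximalRealSubfield L)) L (IsCMField.complexConj L) 3).rightRegular μ).restrict ((archToAdelic (↥(maximalRealSubfield L)) L (IsCMField.complexConj L) 3 ((StdForm.antidiagonal 3).over L)).comp κ)).isotypicComponent τ).toSubmodule ⊓ Aᗮ, P v = v := fun v hv => by
    have h := hScP (Submodule.mem_inf.1 hv).1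
    rw [LinearMap.mem_eqLocus] at h
    rw [hPdef]
    exact h
  -- (c) the body: ★ (N_blk,₃)-conv at `(K′, ω) := (ι_f Kf, 1)`, `Ln := Sc ⊓ N_τ ⊓ Aᗮ`
  have hbody := resG_isotypic_le_orthogonal_of_lineModel_of_conv L μ νinf νf κ hκ μK χ e m 𝔓 (Kf.1.map (finAdelicToAdelic (↥(maximalRealSubfield L)) L (IsCMField.complexConj L) 3 ((StdForm.antidiagonal 3).over L))) 1 hχconv hχinv Kf.1 he0 he1 heK hestar P hPdef T hT𝓐 hTP hTB
    U s hs (fun j v _ => hU j v) hline (resGBlock L μ (Kf.1.map (finAdelicToAdelic (↥(maximalRealSubfield L)) L (IsCMField.complexConj L) 3 ((StdForm.antidiagonal 3).over L))) 1 χ₁ χ₂ ⊓ ((((quasiSplit (↥(maximalRealSubfield L)) L (IsCMField.complexConj L) 3).rightRegular μ).restrict ((archToAdelic (↥(maximalRealSubfield L)) L (IsCMField.complexConj L) 3 ((StdForm.antidiagonal 3).over L)).comp κ)).isotypicComponent τ).toSubmodule ⊓ Aᗮ) hLnP (fun v hv y _ hy => hLnU v hv y hy) W hW hres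
  -- (d) `Fix(ι_f Kf) ≤ Fix_{ι_f Kf}(1)`
  have hFix : (⨅ u : ↥(Kf.1), Module.End.eigenspace ((((quasiSplit (↥(maximalRealSubfield L)) L (IsCMField.complexConj L) 3).rightRegular μ) (finAdelicToAdelic (↥(maximalRealSubfield L)) L (IsCMField.complexConj L) 3 ((StdForm.antidiagonal 3).over L) (u : ↥(finAdelic (↥(maximalRealSubfield L)) L (IsCMField.complexConj L) 3 ((StdForm.antidiagonal 3).over L)))) :
        (quasiSplit (↥(maximalRealSubfield L)) L (IsCMField.complexConj L) 3).L2 μ →L[ℂ] (quasiSplit (↥(maximalRealSubfield L)) L (IsCMField.complexConj L) 3).L2 μ) : (quasiSplit (↥(maximalRealSubfield L)) L (IsCMField.complexConj L) 3).L2 μ →ₗ[ℂ] (quasiSplit (↥(maximalRealSubfield L)) L (IsCMField.complexConj L) 3).L2 μ) 1) ≤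
      ⨅ k : ↥(Kf.1.map (finAdelicToAdelic (↥(maximalRealSubfield L)) L (IsCMField.complexConj L) 3 ((StdForm.antidiagonal 3).over L))), Module.End.eigenspace ((((quasiSplit (↥(maximalRealSubfield L)) L (IsCMField.complexConj L) 3).rightRegular μ) ((Kf.1.map (finAdelicToAdelic (↥(maximalRealSubfield L)) L (IsCMField.complexConj L) 3 ((StdForm.antidiagonal 3).over L))).subtype k) : (quasiSplit (↥(maximalRealSubfield L)) L (IsCMField.complexConj L) 3).L2 μ →L[ℂ] (quasiSplit (↥(maximalRealSubfield L)) L (IsCMField.complexConj L) 3).L2 μ) : (quasiSplit (↥(maximalRealSubfield L)) L (IsCMField.complexConj L) 3).L2 μ →ₗ[ℂ] (quasiSplit (↥(maximalRealSubfield L)) L (IsCMField.complexConj L) 3).L2 μ) ((1 : ↥(Kf.1.map (finAdelicToAdelic (↥(maximalRealSubfield L)) L (IsCMField.complexConj L) 3 ((StdForm.antidiagonal 3).over L))) →* ℂ) k) := by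
    refine le_iInf fun k => ?_
    obtain ⟨u, hu, hk⟩ := Subgroup.mem_map.1 k.2
    have h1 : ((Kf.1.map (finAdelicToAdelic (↥(maximalRealSubfield L)) L (IsCMField.complexConj L) 3 ((StdForm.antidiagonal 3).over L))).subtype k : (quasiSplit (↥(maximalRealSubfield L)) L (IsCMField.complexConj L) 3).Adelic) = finAdelicToAdelic (↥(maximalRealSubfield L)) L (IsCMField.complexConj L) 3 ((StdForm.antidiagonal 3).over L) (⟨u, hu⟩ : ↥(Kf.1)) := hk.symm
    rw [h1, MonoidHom.one_apply]
    exact iInf_le (fun u : ↥(Kf.1) => Module.End.eigenspace ((((quasiSplit (↥(maximalRealSubfield L)) L (IsCMField.complexConj L) 3).rightRegular μ) (finAdelicToAdelic (↥(maximalRealSubfield L)) L (IsCMField.complexConj L) 3 ((StdForm.antidiagonal 3).over L) (u : ↥(finAdelic (↥(maximalRealSubfield L)) L (IsCMField.complexConj L) 3 ((StdForm.antidiagonal 3).over L)))) : (quasiSplit (↥(maximalRealSubfield L)) L (IsCMField.complexConj L) 3).L2 μ →L[ℂ] (quasiSplit (↥(maximalRealSubfield L)) L (IsCMField.complexConj L)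 3).L2 μ) : (quasiSplit (↥(maximalRealSubfield L)) L (IsCMField.complexConj L) 3).L2 μ →ₗ[ℂ] (quasiSplit (↥(maximalRealSubfield L)) L (IsCMField.complexConj L) 3).L2 μ) 1) ⟨u, hu⟩
  exact (inf_le_inf_left _ hFix).trans hbody

end Assembly

section Record

variable (L : Type) [Field L] [NumberField L] [IsCMField L]
  (μ : Measure (quasiSplit (↥(maximalRealSubfield L)) L (IsCMField.complexConj L) 3).automorphicQuotient)
  [(quasiSplit (↥(maximalRealSubfield L)) L (IsCMField.complexConj L) 3).IsAutomorphicMeasure μ]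
  [MeasurableSpace ↥(UnitaryGroup.arch (↥(maximalRealSubfield L)) L (IsCMField.complexConj L) 3 ((StdForm.antidiagonal 3).over L) ⊓ unitaryGroupOfForm (conjMixed (↥(maximalRealSubfield L)) L (IsCMField.complexConj L)) 1)] [BorelSpace ↥(UnitaryGroup.arch (↥(maximalRealSubfield L)) L (IsCMField.complexConj L) 3 ((StdForm.antidiagonal 3).over L) ⊓ unitaryGroupOfForm (conjMixed (↥(maximalRealSubfield L)) L (IsCMField.complexConj L)) 1)] [SecondCountableTopology ↥(UnitaryGroup.arch (↥(maximalRealSubfield L)) L (IsCMField.complexConj L) 3 ((StdForm.antidiagonal 3).over L) ⊓ unitaryGroupOfForm (conjMixed (↥(maximalRealSubfield L)) L (IsCMField.complexConj L)) 1)]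
  [MeasurableSpace (UnitaryGroup.arch (↥(maximalRealSubfield L)) L (IsCMField.complexConj L) 3 ((StdForm.antidiagonal 3).over L))] [BorelSpace (UnitaryGroup.arch (↥(maximalRealSubfield L)) L (IsCMField.complexConj L) 3 ((StdForm.antidiagonal 3).over L))]
  [MeasurableSpace (finAdelic (↥(maximalRealSubfield L)) L (IsCMField.complexConj L) 3 ((StdForm.antidiagonal 3).over L))] [BorelSpace (finAdelic (↥(maximalRealSubfield L)) L (IsCMField.complexConj L) 3 ((StdForm.antidiagonal 3).over L))]
  (νinf : Measure (UnitaryGroup.arch (↥(maximalRealSubfield L)) L (IsCMField.complexConj L) 3 ((StdForm.antidiagonal 3).over L))) [IsFiniteMeasureOnCompacts νinf] [νinf.IsMulLeftInvariant] [νinf.IsInvInvariant] [νinf.IsOpenPosMeasure]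
  (νf : Measure (finAdelic (↥(maximalRealSubfield L)) L (IsCMField.complexConj L) 3 ((StdForm.antidiagonal 3).over L))) [IsFiniteMeasureOnCompacts νf] [νf.IsMulLeftInvariant] [νf.IsInvInvariant] [νf.IsOpenPosMeasure]
  (μK : Measure ↥(UnitaryGroup.arch (↥(maximalRealSubfield L)) L (IsCMField.complexConj L) 3 ((StdForm.antidiagonal 3).over L) ⊓ unitaryGroupOfForm (conjMixed (↥(maximalRealSubfield L)) L (IsCMField.complexConj L)) 1)) [IsFiniteMeasureOnCompacts μK] [IsProbabilityMeasure μK] [μK.IsMulLeftInvariant] [μK.IsInvInvariant]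
  (χ : C_c(↥(UnitaryGroup.arch (↥(maximalRealSubfield L)) L (IsCMField.complexConj L) 3 ((StdForm.antidiagonal 3).over L) ⊓ unitaryGroupOfForm (conjMixed (↥(maximalRealSubfield L)) L (IsCMField.complexConj L)) 1), ℂ)) (e : C_c(finAdelic (↥(maximalRealSubfield L)) L (IsCMField.complexConj L) 3 ((StdForm.antidiagonal 3).over L), ℂ))
  {Ω : Type*} {mΩ : MeasurableSpace Ω} (m : Measure Ω) {E : Type*} [NormedAddCommGroup E] [InnerProductSpace ℂ E] [CompleteSpace E] {J : Type*} [Countable J]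
variable [ENNReal.HolderTriple ∞ 2 2]

/-- **THE τ-CUT ASSEMBLER AT THE RECORD: `K := K_∞ = U(J₃)(L⁺⊗ℝ) ∩ U(1⊗1)`, `κ :=` the inclusion, generators `x :=` the PB-0′ wave packets `[θ_{f, e_τ φ}]`** (★
`resGBlock_inf_isotypicComponent_eq_topologicalClosure_span_tauAverage`, `χ₁` unitary — `hΘ` DISCHARGED).  The PB-2 ∕ PB-3a letters are stated for any family `x` enumerating that generator set (`hx : range x = 𝒢_τ`; e.g. `x := Subtype.val`,
`hx := Subtype.range_coe`); all other binders as in `hcut_of_plancherelBody`.  CONCLUSION: the `hcut τ` bytes of ★ `hNblk_of_tauCuts` VERBATIM (`τ` an irreducible unitary `K_∞`-type on `Eτ`). [cite: MoeglinWaldspurger1995, II.2.4, VI.2]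
[cite: BrockerTomDieck1985, III Thm. (5.10)] -/
theorem hcut_of_plancherelBody_of_record (𝔓 : (quasiSplit (↥(maximalRealSubfield L)) L (IsCMField.complexConj L) 3).ParabolicUnipotentData)
    (Kf : {Kf : Subgroup ↥(finAdelic (↥(maximalRealSubfield L)) L (IsCMField.complexConj L) 3 ((StdForm.antidiagonal 3).over L)) // IsOpen ((Kf : Subgroup ↥(finAdelic (↥(maximalRealSubfield L)) L (IsCMField.complexConj L) 3 ((StdForm.antidiagonal 3).over L))) : Set ↥(finAdelic (↥(maximalRealSubfield L)) L (IsCMField.complexConj L) 3 ((StdForm.antidiagonal 3).over L))) ∧ Kf ≤ ((((standardMaximalCompactGL 3 L).comap (adelicVal (↥(maximalRealSubfield L)) L (IsCMField.complexConj L) 3 ((StdForm.antidiagonal 3).over L)) : Subgroup (quasiSplit (↥(maximalRealSubfield L)) L (IsCMField.complexConj L) 3).Adelic)).comap (finAdelicToAdelic (↥(maximalRealSubfield L)) L (IsCMField.complexConj L) 3 ((StdForm.antidiagonal 3).over L)) : Subgroup ↥(finAdelic (↥(maximalRealSubfield L)) L (IsCMField.complexConj L) 3 ((StdForm.antidiagonal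 3).over L)))})
    {χ₁ : HeckeCharacter L} (hχ₁ : χ₁.IsUnitary) {χ₂ : ↥(TorusDict.torus (IsCMField.complexConj L)) →ₜ* ℂˣ} (hχ₂ : TorusDict.IsAutomorphic (IsCMField.complexConj L) χ₂)
    {Eτ : Type*} [NormedAddCommGroup Eτ] [InnerProductSpace ℂ Eτ] [FiniteDimensional ℂ Eτ] (τ : ContRepresentation ℂ ↥(UnitaryGroup.arch (↥(maximalRealSubfield L)) L (IsCMField.complexConj L) 3 ((StdForm.antidiagonal 3).over L) ⊓ unitaryGroupOfForm (conjMixed (↥(maximalRealSubfield L)) L (IsCMField.complexConj L)) 1) Eτ) (hτc : Continuous (τ : ↥(UnitaryGroup.arch (↥(maximalRealSubfield L)) L (IsCMField.complexConj L) 3 ((StdForm.antidiagonal 3).over L) ⊓ unitaryGroupOfForm (conjMixed (↥(maximalRealSubfield L)) L (IsCMField.complexConj L)) 1) → Eτ →L[ℂ] Eτ))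
    [τ.toRepresentation.IsIrreducible] (hτu : ∀ (k : ↥(UnitaryGroup.arch (↥(maximalRealSubfield L)) L (IsCMField.complexConj L) 3 ((StdForm.antidiagonal 3).over L) ⊓ unitaryGroupOfForm (conjMixed (↥(maximalRealSubfield L)) L (IsCMField.complexConj L)) 1)) (v w : Eτ), ⟪τ k v, τ k w⟫_ℂ = ⟪v, w⟫_ℂ)
    (hχτ : ∀ k, χ k = (Module.finrank ℂ Eτ : ℂ) * conj (Schur.character τ k)) (hχconv : ∀ x, χ x = mulConv μK (⇑χ) (⇑χ) x) (hχinv : ∀ k, conj (χ k⁻¹) = χ k)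
    (he0 : ∀ x : finAdelic (↥(maximalRealSubfield L)) L (IsCMField.complexConj L) 3 ((StdForm.antidiagonal 3).over L), x ∉ Kf.1 → e x = 0) (he1 : ∫ x, e x ∂νf = 1) (heK : ∀ k ∈ Kf.1, ∀ x, e (k * x) = e x) (hestar : ∀ x : finAdelic (↥(maximalRealSubfield L)) L (IsCMField.complexConj L) 3 ((StdForm.antidiagonal 3).over L), mulStar (⇑e) x = e x)
    (P : (quasiSplit (↥(maximalRealSubfield L)) L (IsCMField.complexConj L) 3).L2 μ →L[ℂ] (quasiSplit (↥(maximalRealSubfield L)) L (IsCMField.complexConj L) 3).L2 μ)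
    (hPdef : P = ((((quasiSplit (↥(maximalRealSubfield L)) L (IsCMField.complexConj L) 3).rightRegular μ).restrict ((archToAdelic (↥(maximalRealSubfield L)) L (IsCMField.complexConj L) 3 ((StdForm.antidiagonal 3).over L)).comp (Subgroup.inclusion (inf_le_left : (UnitaryGroup.arch (↥(maximalRealSubfield L)) L (IsCMField.complexConj L) 3 ((StdForm.antidiagonal 3).over L) ⊓
                unitaryGroupOfForm (conjMixed (↥(maximalRealSubfield L)) L (IsCMField.complexConj L)) 1) ≤ UnitaryGroup.arch (↥(maximalRealSubfield L)) L (IsCMField.complexConj L) 3 ((StdForm.antidiagonal 3).over L))))).integratedOperator (((quasiSplit (↥(maximalRealSubfield L)) L (IsCMField.complexConj L) 3).isUnitary_rightRegular μ).restrict _)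
          (((quasiSplit (↥(maximalRealSubfield L)) L (IsCMField.complexConj L) 3).isStronglyContinuous_rightRegular_holds μ).restrict _ ((continuous_archToAdelic (↥(maximalRealSubfield L)) L (IsCMField.complexConj L) 3 ((StdForm.antidiagonal 3).over L)).comp (continuous_inclusion_arch_inf_unitaryOne L 3 ((StdForm.antidiagonal 3).over L)))) μK χ ∘L
        (((quasiSplit (↥(maximalRealSubfield L)) L (IsCMField.complexConj L) 3).rightRegular μ).restrict (finAdelicToAdelic (↥(maximalRealSubfield L)) L (IsCMField.complexConj L) 3 ((StdForm.antidiagonal 3).over L))).integratedOperator (((quasiSplit (↥(maximalRealSubfield L)) L (IsCMField.complexConj L) 3).isUnitary_rightRegular μ).restrict _) (((quasiSplit (↥(maximalRealSubfield L)) L (IsCMField.complexConj L) 3).isStronglyContinuous_rightRegular_holds μ).restrict _ (continuous_finAdelicToAdelic (↥(maximalRealSubfield L)) L (IsCMField.complexConj L) 3 ((StdForm.antidiagonal 3).over L))) νf e))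
    (T : J → (quasiSplit (↥(maximalRealSubfield L)) L (IsCMField.complexConj L) 3).L2 μ →L[ℂ] (quasiSplit (↥(maximalRealSubfield L)) L (IsCMField.complexConj L) 3).L2 μ)
    (hT𝓐 : ∀ j, T j ∈ {A' : (quasiSplit (↥(maximalRealSubfield L)) L (IsCMField.complexConj L) 3).L2 μ →L[ℂ] (quasiSplit (↥(maximalRealSubfield L)) L (IsCMField.complexConj L) 3).L2 μ | ∃ (a : C_c(UnitaryGroup.arch (↥(maximalRealSubfield L)) L (IsCMField.complexConj L) 3 ((StdForm.antidiagonal 3).over L), ℂ)) (b : C_c(finAdelic (↥(maximalRealSubfield L)) L (IsCMField.complexConj L) 3 ((StdForm.antidiagonal 3).over L), ℂ)),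
      A' = (((quasiSplit (↥(maximalRealSubfield L)) L (IsCMField.complexConj L) 3).rightRegular μ).restrict (archToAdelic (↥(maximalRealSubfield L)) L (IsCMField.complexConj L) 3 ((StdForm.antidiagonal 3).over L))).integratedOperator (((quasiSplit (↥(maximalRealSubfield L)) L (IsCMField.complexConj L) 3).isUnitary_rightRegular μ).restrict _) (((quasiSplit (↥(maximalRealSubfield L)) L (IsCMField.complexConj L) 3).isStronglyContinuous_rightRegular_holds μ).restrict _ (continuous_archToAdelic (↥(maximalRealSubfield L)) L (IsCMField.complexConj L) 3 ((StdForm.antidiagonal 3).over L))) νinf a ∘L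
          (((quasiSplit (↥(maximalRealSubfield L)) L (IsCMField.complexConj L) 3).rightRegular μ).restrict (finAdelicToAdelic (↥(maximalRealSubfield L)) L (IsCMField.complexConj L) 3 ((StdForm.antidiagonal 3).over L))).integratedOperator (((quasiSplit (↥(maximalRealSubfield L)) L (IsCMField.complexConj L) 3).isUnitary_rightRegular μ).restrict _) (((quasiSplit (↥(maximalRealSubfield L)) L (IsCMField.complexConj L) 3).isStronglyContinuous_rightRegular_holds μ).restrict _ (continuous_finAdelicToAdelic (↥(maximalRealSubfield L)) L (IsCMField.complexConj L) 3 ((StdForm.antidiagonal 3).over L))) νf b})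
    (hTP : ∀ j, Commute P (T j))
    (hTB : ∀ j, ∀ A' ∈ {A' : (quasiSplit (↥(maximalRealSubfield L)) L (IsCMField.complexConj L) 3).L2 μ →L[ℂ] (quasiSplit (↥(maximalRealSubfield L)) L (IsCMField.complexConj L) 3).L2 μ | ∃ (a : C_c(UnitaryGroup.arch (↥(maximalRealSubfield L)) L (IsCMField.complexConj L) 3 ((StdForm.antidiagonal 3).over L), ℂ)) (b : C_c(finAdelic (↥(maximalRealSubfield L)) L (IsCMField.complexConj L) 3 ((StdForm.antidiagonal 3).over L), ℂ)),
      A' = (((quasiSplit (↥(maximalRealSubfield L)) L (IsCMField.complexConj L) 3).rightRegular μ).restrict (archToAdelic (↥(maximalRealSubfield L)) L (IsCMField.complexConj L) 3 ((StdForm.antidiagonal 3).over L))).integratedOperator (((quasiSplit (↥(maximalRealSubfield L)) L (IsCMField.complexConj L) 3).isUnitary_rightRegular μ).restrict _) (((quasiSplit (↥(maximalRealSubfield L)) L (IsCMField.complexConj L) 3).isStronglyContinuous_rightRegular_holds μ).restrict _ (continuous_archToAdelic (↥(maximalRealSubfield L)) L (IsCMField.complexConj L) 3 ((StdForm.antidiagonal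 3).over L))) νinf a ∘L
          (((quasiSplit (↥(maximalRealSubfield L)) L (IsCMField.complexConj L) 3).rightRegular μ).restrict (finAdelicToAdelic (↥(maximalRealSubfield L)) L (IsCMField.complexConj L) 3 ((StdForm.antidiagonal 3).over L))).integratedOperator (((quasiSplit (↥(maximalRealSubfield L)) L (IsCMField.complexConj L) 3).isUnitary_rightRegular μ).restrict _) (((quasiSplit (↥(maximalRealSubfield L)) L (IsCMField.complexConj L) 3).isStronglyContinuous_rightRegular_holds μ).restrict _ (continuous_finAdelicToAdelic (↥(maximalRealSubfield L)) L (IsCMField.complexConj L) 3 ((StdForm.antidiagonal 3).over L))) νf b},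
      ∀ x ∈ LinearMap.eqLocus (P : (quasiSplit (↥(maximalRealSubfield L)) L (IsCMField.complexConj L) 3).L2 μ →ₗ[ℂ] (quasiSplit (↥(maximalRealSubfield L)) L (IsCMField.complexConj L) 3).L2 μ) LinearMap.id, P (A' (T j x)) = T j (P (A' x)))
    {ι : Type*} (x : ι → (quasiSplit (↥(maximalRealSubfield L)) L (IsCMField.complexConj L) 3).L2 μ) (hx : Set.range x = {v : (quasiSplit (↥(maximalRealSubfield L)) L (IsCMField.complexConj L) 3).L2 μ |
          ∃ (f : ℝ → ℂ) (_ : Continuous f) (_ : HasCompactSupport f) (_ : tsupport f ⊆ Ioi 0)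
            (φ : (quasiSplit (↥(maximalRealSubfield L)) L (IsCMField.complexConj L) 3).Adelic → ℂ)
            (_ : φ ∈ chiSectionSpacePair χ₁ χ₂ (Kf.1.map (finAdelicToAdelic (↥(maximalRealSubfield L)) L (IsCMField.complexConj L) 3 ((StdForm.antidiagonal 3).over L))) ((1 : ↥(Kf.1.map (finAdelicToAdelic (↥(maximalRealSubfield L)) L (IsCMField.complexConj L) 3 ((StdForm.antidiagonal 3).over L))) →* ℂ) : ↥(Kf.1.map (finAdelicToAdelic (↥(maximalRealSubfield L)) L (IsCMField.complexConj L) 3 ((StdForm.antidiagonal 3).over L))) → ℂ)) (_ : Continuous φ)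
            (_ : MemLp ((quasiSplit (↥(maximalRealSubfield L)) L (IsCMField.complexConj L) 3).quotFun (eisensteinSeriesU (fun g => f (borelHeight g) * φ g))) 2 μ)
            (hv' : MemLp ((quasiSplit (↥(maximalRealSubfield L)) L (IsCMField.complexConj L) 3).quotFun (eisensteinSeriesU (fun g : (quasiSplit (↥(maximalRealSubfield L)) L (IsCMField.complexConj L) 3).Adelic =>
              f (borelHeight g : ℝ) * ∫ k, ((Module.finrank ℂ Eτ : ℂ) * conj (Schur.character τ k)) * φ (g * ((archToAdelic (↥(maximalRealSubfield L)) L (IsCMField.complexConj L) 3 ((StdForm.antidiagonal 3).over L)).comp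
              (Subgroup.inclusion (inf_le_left : (UnitaryGroup.arch (↥(maximalRealSubfield L)) L (IsCMField.complexConj L) 3 ((StdForm.antidiagonal 3).over L) ⊓
                unitaryGroupOfForm (conjMixed (↥(maximalRealSubfield L)) L (IsCMField.complexConj L)) 1) ≤ UnitaryGroup.arch (↥(maximalRealSubfield L)) L (IsCMField.complexConj L) 3 ((StdForm.antidiagonal 3).over L)))) k) ∂μK))) 2 μ), v = hv'.toLp _})
    {M₁ : Type*} [NormedAddCommGroup M₁] [InnerProductSpace ℂ M₁] [CompleteSpace M₁] (r : ι → M₁) (c : ι → Lp E 2 m)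
    (hG : ∀ i j, ⟪x i, x j⟫_ℂ = ⟪r i, r j⟫_ℂ + ⟪c i, c j⟫_ℂ)
    {kι : Type*} (eres : kι → (quasiSplit (↥(maximalRealSubfield L)) L (IsCMField.complexConj L) 3).L2 μ) (b : kι → M₁)
    (hee : ∀ p q, ⟪eres p, eres q⟫_ℂ = ⟪b p, b q⟫_ℂ) (hxe : ∀ i p, ⟪x i, eres p⟫_ℂ = ⟪r i, b p⟫_ℂ) (hr : ∀ i, r i ∈ (Submodule.span ℂ (Set.range b)).topologicalClosure)
    (σ : J → ι → ι) (hTx : ∀ j i, T j (x i) = x (σ j i)) (hTadjx : ∀ j i, ContinuousLinearMap.adjoint (T j) (x i) ∈ (Submodule.span ℂ (Set.range x)).topologicalClosure)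
    (s : J → Ω → ℂ) (hs : ∀ j, MemLp (s j) ∞ m) (hSymb : ∀ j i, c (σ j i) = (hs j).toLp (s j) • c i)
    (A : Submodule ℂ ((quasiSplit (↥(maximalRealSubfield L)) L (IsCMField.complexConj L) 3).L2 μ)) (hRA : (Submodule.span ℂ (Set.range eres)).topologicalClosure ≤ A)
    (hline : ∀ cst : J → ℂ, m {y | ∀ j, s j y = cst j} = 0) :
    ∀ W : ClosedSubrep ((quasiSplit (↥(maximalRealSubfield L)) L (IsCMField.complexConj L) 3).rightRegular μ), W.toContRep.IsTopIrreducible → W ≤ residualSubspace (quasiSplit (↥(maximalRealSubfield L)) L (IsCMField.complexConj L) 3) μ 𝔓 →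
      W.toSubmodule ⊓ (⨅ u : ↥(Kf.1), Module.End.eigenspace ((((quasiSplit (↥(maximalRealSubfield L)) L (IsCMField.complexConj L) 3).rightRegular μ) (finAdelicToAdelic (↥(maximalRealSubfield L)) L (IsCMField.complexConj L) 3 ((StdForm.antidiagonal 3).over L) (u : ↥(finAdelic (↥(maximalRealSubfield L)) L (IsCMField.complexConj L) 3 ((StdForm.antidiagonal 3).over L)))) :
        (quasiSplit (↥(maximalRealSubfield L)) L (IsCMField.complexConj L) 3).L2 μ →L[ℂ] (quasiSplit (↥(maximalRealSubfield L)) L (IsCMField.complexConj L) 3).L2 μ) : (quasiSplit (↥(maximalRealSubfield L)) L (IsCMField.complexConj L) 3).L2 μ →ₗ[ℂ] (quasiSplit (↥(maximalRealSubfield L)) L (IsCMField.complexConj L) 3).L2 μ) 1) ≤ (resGBlock L μ (Kf.1.map (finAdelicToAdelic (↥(maximalRealSubfield L)) L (IsCMField.complexConj L) 3 ((StdForm.antidiagonal 3).over L))) 1 χ₁ χ₂ ⊓ ((((quasiSplit (↥(maximalRealSubfield L)) L (IsCMField.complexConj L) 3).rightRegular μ).restrict ((archToAdelic (↥(maximalRealSubfield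 L)) L (IsCMField.complexConj L) 3 ((StdForm.antidiagonal 3).over L)).comp (Subgroup.inclusion (inf_le_left : (UnitaryGroup.arch (↥(maximalRealSubfield L)) L (IsCMField.complexConj L) 3 ((StdForm.antidiagonal 3).over L) ⊓
                unitaryGroupOfForm (conjMixed (↥(maximalRealSubfield L)) L (IsCMField.complexConj L)) 1) ≤ UnitaryGroup.arch (↥(maximalRealSubfield L)) L (IsCMField.complexConj L) 3 ((StdForm.antidiagonal 3).over L))))).isotypicComponent τ).toSubmodule ⊓ Aᗮ)ᗮ := by
  haveI : CompactSpace ↥(UnitaryGroup.arch (↥(maximalRealSubfield L)) L (IsCMField.complexConj L) 3 ((StdForm.antidiagonal 3).over L) ⊓ unitaryGroupOfForm (conjMixed (↥(maximalRealSubfield L)) L (IsCMField.complexConj L)) 1) := compactSpace_arch_inf_unitaryOne L 3 ((StdForm.antidiagonal 3).over L)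
  have hΘ' := resGBlock_inf_isotypicComponent_eq_topologicalClosure_span_tauAverage L μ μK Kf.1 τ hτc hτu hχ₁ hχ₂
  have hΘ : (Submodule.span ℂ (Set.range x)).topologicalClosure = resGBlock L μ (Kf.1.map (finAdelicToAdelic (↥(maximalRealSubfield L)) L (IsCMField.complexConj L) 3 ((StdForm.antidiagonal 3).over L))) 1 χ₁ χ₂ ⊓ ((((quasiSplit (↥(maximalRealSubfield L)) L (IsCMField.complexConj L) 3).rightRegular μ).restrict ((archToAdelic (↥(maximalRealSubfield L)) L (IsCMField.complexConj L) 3 ((StdForm.antidiagonal 3).over L)).comp (Subgroup.inclusion (inf_le_left : (UnitaryGroup.arch (↥(maximalRealSubfield L)) L (IsCMField.complexConj L) 3 ((StdForm.antidiagonal 3).over L) ⊓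
                unitaryGroupOfForm (conjMixed (↥(maximalRealSubfield L)) L (IsCMField.complexConj L)) 1) ≤ UnitaryGroup.arch (↥(maximalRealSubfield L)) L (IsCMField.complexConj L) 3 ((StdForm.antidiagonal 3).over L))))).isotypicComponent τ).toSubmodule := by
    rw [hx]; exact hΘ'.symm
  exact hcut_of_plancherelBody L μ νinf νf (Subgroup.inclusion (inf_le_left : (UnitaryGroup.arch (↥(maximalRealSubfield L)) L (IsCMField.complexConj L) 3 ((StdForm.antidiagonal 3).over L) ⊓
                unitaryGroupOfForm (conjMixed (↥(maximalRealSubfield L)) L (IsCMField.complexConj L)) 1) ≤ UnitaryGroup.arch (↥(maximalRealSubfield L)) L (IsCMField.complexConj L) 3 ((StdForm.antidiagonal 3).over L))) (continuous_inclusion_arch_inf_unitaryOne L 3 ((StdForm.antidiagonal 3).over L)) μK χ e m 𝔓 Kf χ₁ hχ₂ τ hτc hτu hχτ hχconv hχinv he0 he1 heK hestar P hPdef T hT𝓐 hTP hTB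
    x r c hG eres b hee hxe hr σ hTx hTadjx s hs hSymb A hRA hΘ hline

end Record

end Summit.HodgeConjecture.HodgeConjecture.R90.S8

end
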